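import Summits.QuantumAdvantage.QuantumAdvantage.Theorems.SymplecticPurityDeqThesisOneSidedFlat

/-!
# Crux `DeqThesis` (stmt-QuantumAdvantage-0242), line `Sketch` — stub `stub_hlikeFlat` (regime K4c), lemmas

The ROW-FOURIER regime of the core (lead, cycle 2). Write
`2ⁿ⟨ĝ|⊗ₖMₖ|ĝ⟩ = Σ_x Σ_{x'} (∏ᵢ Mᵢ(xᵢ,x'ᵢ)) (∏ⱼ M_{n+j}((Fx)ⱼ,(Fx')ⱼ))`, FIX the row index `x`, and expand
each one-bit function `b ↦ Mₖ(ξ, b)` in the two characters of `b`: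
`Mₖ(ξ,b) = ½(Mₖ(ξ,0)+Mₖ(ξ,1)) + ½(Mₖ(ξ,0)−Mₖ(ξ,1))(−1)^b`. The inner sum over `x'` becomes a combination
of cube Walsh sums `Σ_{x'} (−1)^{α·x' + γ·F(x')}` (`≤ 2√2ⁿ` unless `α = γ = 0`, `OneSided.abs_sum_sign_cube_le`)
with total coefficient mass `∏ₖ μₖ`, `μₖ := ½(|Mₖ(0,0)+Mₖ(0,1)| + |Mₖ(0,0)−Mₖ(0,1)|) ∈ [2^{-1/2}, 1]`
(the same for both rows since `Mₖ = uₖσuₖ†` is Hermitian and traceless, or `= 1`). The doubly-zero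
frequency leaves `Σ_x` of (half row sums of the input factors) × (those of the value factors at `F x`),
which is a sum of the same shape with per-site masses `≤ 2^{-1/2}` and is expanded once more. Result
(`norm_graph_dot_le_hlike`):

  `|⟨ĝ| ⊗ₖ uₖσ_{Sₖ}uₖ† |ĝ⟩| ≤ 2√2ⁿ ∏_{k<2n} μₖ + 2^{-n}(2√2ⁿ + 1)`,

so the expectation is `≤ 2^{-n/16}` once `∏ₖ μₖ ≤ 2^{-5n/8}` and `n ≥ 48` (`stub_hlikeFlat`). `μ = 2^{-1/2}`
exactly for Hadamard-like sites (polar 45°, azimuth 0 or π), `μ = 1` for untilted sites and for azimuth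
±90°; this regime is transverse to the light / unbalanced ones and removes from the doubly-balanced core
every test whose azimuths stay within ≈ 24° of the X–Z plane on average over the 2n sites.
-/

set_option linter.dupNamespace false -- D-0017: single-problem summit ⇒ `QuantumAdvantage.QuantumAdvantage` by design

noncomputable section

namespace Summit.QuantumAdvantage.QuantumAdvantage.Theorems.SymplecticPurity

open Matrix Finset Literature.Computability.QuantumComplexity Literature.Computability.Cryptography

namespace HLike

/-! ### Character expansion of one-bit and product functions -/

/-- `p b = ½(p 0 + p 1) + ½(p 0 − p 1)(−1)^b`, with the sign written in the `ZMod 2` form of the cube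
Walsh lemmas. -/
theorem apply_eq_half (p : Bool → ℂ) (b : Bool) :
    p b = (p false + p true) / 2 +
      (p false - p true) / 2 * ((if (if b then (1 : ZMod 2) else 0) = 0 then (1 : ℝ) else -1 : ℝ) : ℂ) := by
  cases b <;> simp <;> ring

/-- The masked sign `(−1)^{a ∧ b}` in the `ZMod 2` form of the Walsh lemmas. -/
theorem sgn_mask (a b : Bool) :
    (if (if a then (1 : ZMod 2) else 0) * (if b then (1 : ZMod 2) else 0) = 0 then (1 : ℝ) else -1) =
      if a then (if (if b then (1 : ZMod 2) else 0) = 0 then (1 : ℝ) else -1) else 1 := by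
  cases a <;> cases b <;> simp

/-- One site: `p b = Σ_a ĉ(a) · (−1)^{a ∧ b}` with `ĉ(0) = ½(p0 + p1)`, `ĉ(1) = ½(p0 − p1)`. -/
theorem apply_eq_sum_coef (p : Bool → ℂ) (b : Bool) :
    p b = ∑ a : Bool, (if a then (p false - p true) / 2 else (p false + p true) / 2) *
      ((if a then (if (if b then (1 : ZMod 2) else 0) = 0 then (1 : ℝ) else -1) else 1 : ℝ) : ℂ) := by
  rw [Fintype.sum_bool]
  cases b <;> simp <;> ring

/-- **Character expansion of a product function**:
`∏ᵢ pᵢ(bᵢ) = Σ_α (∏ᵢ ĉᵢ(αᵢ)) · (−1)^{Σᵢ αᵢ bᵢ}`. -/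
theorem prod_apply_eq_sum {m : ℕ} (p : Fin m → Bool → ℂ) (b : Fin m → Bool) :
    ∏ i, p i (b i) = ∑ α : Fin m → Bool, (∏ i, (if α i then (p i false - p i true) / 2 else (p i false + p i true) / 2)) *
      ((if ∑ i, (if α i then (1 : ZMod 2) else 0) * (if b i then (1 : ZMod 2) else 0) = 0
        then (1 : ℝ) else -1 : ℝ) : ℂ) := by
  simp_rw [← prod_sign_eq, sgn_mask, Complex.ofReal_prod, ← Finset.prod_mul_distrib]
  rw [← Fintype.prod_sum fun i (a : Bool) => (if a then (p i false - p i true) / 2 else (p i false + p i true) / 2) *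
    ((if a then (if (if b i then (1 : ZMod 2) else 0) = 0 then (1 : ℝ) else -1) else 1 : ℝ) : ℂ)]
  exact Finset.prod_congr rfl fun i _ => apply_eq_sum_coef (p i) (b i)

/-- The coefficient mass of a product function factorises:
`Σ_α ‖∏ᵢ ĉᵢ(αᵢ)‖ = ∏ᵢ ½(‖pᵢ0 + pᵢ1‖ + ‖pᵢ0 − pᵢ1‖)`. -/
theorem sum_norm_prod_coef {m : ℕ} (p : Fin m → Bool → ℂ) :
    ∑ α : Fin m → Bool, ‖∏ i, (if α i then (p i false - p i true) / 2 else (p i false + p i true) / 2)‖ =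
      ∏ i, ((‖p i false + p i true‖ + ‖p i false - p i true‖) / 2) := by
  simp_rw [norm_prod]
  rw [← Fintype.prod_sum fun i (a : Bool) => ‖(if a then (p i false - p i true) / 2 else (p i false + p i true) / 2)‖]
  refine Finset.prod_congr rfl fun i _ => ?_
  rw [Fintype.sum_bool]
  simp only [if_true, Bool.false_eq_true, if_false, norm_div, RCLike.norm_ofNat]
  ring

/-- The zero-frequency coefficient of a product function. -/
theorem prod_coef_false {m : ℕ} (p : Fin m → Bool → ℂ) :
    ∏ i, (if (fun _ => false : Fin m → Bool) i then (p i false - p i true) / 2 else (p i false + p i true) / 2) =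
      ∏ i, (p i false + p i true) / 2 := by
  simp

/-! ### The inner (column) sum against the cube -/

section Inner

variable {n : ℕ} {K : Type*} [Field K] [Fintype K]

/-- The cube Walsh sums in mask form with the doubly-zero frequency removed:
`|Σ_{x'} (−1)^{α·x' + γ·F x'} − [α = 0 ∧ γ = 0] 2ⁿ| ≤ 2√2ⁿ`. -/
theorem abs_walsh_mask_sub_le (hK : Fintype.card K = 2 ^ n) (e : K ≃+ (Fin n → ZMod 2))
    (α γ : Fin n → Bool) :
    |(∑ x : QReg n, (if (∑ i, (if α i then (1 : ZMod 2) else 0) * (if x i then (1 : ZMod 2) else 0)) +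
        ∑ j, (if γ j then (1 : ZMod 2) else 0) *
          e ((e.symm fun i : Fin n => if x i then 1 else 0) ^ 3) j = 0 then (1 : ℝ) else -1)) -
        (if α = (fun _ => false) ∧ γ = (fun _ => false) then (2 : ℝ) ^ n else 0)| ≤
      2 * Real.sqrt 2 ^ n := by
  classical
  by_cases h0 : α = (fun _ => false) ∧ γ = (fun _ => false)
  · obtain ⟨rfl, rfl⟩ := h0
    have h1 : ∀ x : QReg n, (if (∑ i, (if (fun _ : Fin n => false) i then (1 : ZMod 2) else 0) *
          (if x i then (1 : ZMod 2) else 0)) +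
        ∑ j, (if (fun _ : Fin n => false) j then (1 : ZMod 2) else 0) *
          e ((e.symm fun i : Fin n => if x i then 1 else 0) ^ 3) j = 0 then (1 : ℝ) else -1) = 1 := by
      intro x
      simp
    rw [Finset.sum_congr rfl (fun x _ => h1 x), Finset.sum_const, Finset.card_univ, nsmul_eq_mul, mul_one,
      if_pos ⟨rfl, rfl⟩, show (Fintype.card (QReg n) : ℝ) = 2 ^ n by simp [QReg],
      sub_self, abs_zero]
    positivity
  · rw [if_neg h0, sub_zero]
    have hm : (fun i => if α i then (1 : ZMod 2) else 0) ≠ 0 ∨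
        (fun j => if γ j then (1 : ZMod 2) else 0) ≠ 0 := by
      rw [← not_and_or]
      rintro ⟨hα, hγ⟩
      apply h0
      refine ⟨funext fun i => ?_, funext fun j => ?_⟩
      · have h := congrFun hα i
        by_cases hi : α i
        · simp [hi] at h
        · simpa using hi
      · have h := congrFun hγ j
        by_cases hj : γ j
        · simp [hj] at h
        · simpa using hj
    exact OneSided.abs_sum_sign_cube_le hK e _ _ hm

/-- **The inner sum, zero frequency removed.** For one-bit functions `pᵢ` (input sites) and `qⱼ`
(value sites),
`‖Σ_{x'} ∏ᵢ pᵢ(x'ᵢ) ∏ⱼ qⱼ((F x')ⱼ) − P₀ Q₀ 2ⁿ‖ ≤ μ(p) μ(q) · 2√2ⁿ`, where `μ` is the coefficient mass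
and `P₀ = ∏ᵢ ½(pᵢ0 + pᵢ1)`, `Q₀ = ∏ⱼ ½(qⱼ0 + qⱼ1)` are the zero-frequency coefficients. -/
theorem norm_inner_sub_le (hK : Fintype.card K = 2 ^ n) (e : K ≃+ (Fin n → ZMod 2))
    (F : QReg n → QReg n)
    (hF : ∀ x j, F x j = decide (e ((e.symm fun i : Fin n => if x i then 1 else 0) ^ 3) j = 1))
    (p q : Fin n → Bool → ℂ) :
    ‖(∑ x' : QReg n, (∏ i, p i (x' i)) * ∏ j, q j (F x' j)) -
        ((∏ i, (p i false + p i true) / 2) * ∏ j, (q j false + q j true) / 2) * (2 : ℂ) ^ n‖ ≤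
      (∏ i, ((‖p i false + p i true‖ + ‖p i false - p i true‖) / 2)) *
          (∏ j, ((‖q j false + q j true‖ + ‖q j false - q j true‖) / 2)) * (2 * Real.sqrt 2 ^ n) := by
  classical
  have hbit : ∀ x j, (if F x j then (1 : ZMod 2) else 0) =
      e ((e.symm fun i : Fin n => if x i then 1 else 0) ^ 3) j := by
    intro x j
    rw [hF]
    simp only [decide_eq_true_eq, bit_eq_self]
  -- the Walsh sums and their zero-frequency-corrected versions
  set W : (Fin n → Bool) → (Fin n → Bool) → ℝ := fun α γ =>
    ∑ x' : QReg n, (if (∑ i, (if α i then (1 : ZMod 2) else 0) * (if x' i then (1 : ZMod 2) else 0)) +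
      ∑ j, (if γ j then (1 : ZMod 2) else 0) *
        e ((e.symm fun i : Fin n => if x' i then 1 else 0) ^ 3) j = 0 then (1 : ℝ) else -1) with hWdef
  set Z : (Fin n → Bool) → (Fin n → Bool) → ℝ := fun α γ =>
    if α = (fun _ => false) ∧ γ = (fun _ => false) then (2 : ℝ) ^ n else 0 with hZdef
  -- expand both product functions and exchange the sums
  have hexp : ∑ x' : QReg n, (∏ i, p i (x' i)) * ∏ j, q j (F x' j) =
      ∑ α : Fin n → Bool, ∑ γ : Fin n → Bool,
        ((∏ i, (if α i then (p i false - p i true) / 2 else (p i false + p i true) / 2)) * ∏ j, (if γ j then (q j false - q j true) / 2 else (q j false + q j true) / 2)) * (W α γ : ℂ) := by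
    calc ∑ x' : QReg n, (∏ i, p i (x' i)) * ∏ j, q j (F x' j)
        = ∑ x' : QReg n, ∑ α : Fin n → Bool, ∑ γ : Fin n → Bool,
            ((∏ i, (if α i then (p i false - p i true) / 2 else (p i false + p i true) / 2)) * ∏ j, (if γ j then (q j false - q j true) / 2 else (q j false + q j true) / 2)) *
              ((if (∑ i, (if α i then (1 : ZMod 2) else 0) * (if x' i then (1 : ZMod 2) else 0)) +
                ∑ j, (if γ j then (1 : ZMod 2) else 0) *
                  e ((e.symm fun i : Fin n => if x' i then 1 else 0) ^ 3) j = 0 then (1 : ℝ) else -1 : ℝ) : ℂ) := by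
          refine Finset.sum_congr rfl fun x' _ => ?_
          rw [prod_apply_eq_sum p x', prod_apply_eq_sum q (F x'), Finset.sum_mul_sum]
          refine Finset.sum_congr rfl fun α _ => Finset.sum_congr rfl fun γ _ => ?_
          simp_rw [hbit]
          rw [← sign_mul_sign]
          push_cast
          ring
      _ = _ := by
          rw [Finset.sum_comm]
          refine Finset.sum_congr rfl fun α _ => ?_
          rw [Finset.sum_comm]
          refine Finset.sum_congr rfl fun γ _ => ?_
          rw [← Finset.mul_sum, hWdef, Complex.ofReal_sum]
  -- the zero-frequency term is the `(0,0)` summand of the same double sum with `Z` in place of `W`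
  have hzero : ((∏ i, (p i false + p i true) / 2) * ∏ j, (q j false + q j true) / 2) * (2 : ℂ) ^ n =
      ∑ α : Fin n → Bool, ∑ γ : Fin n → Bool,
        ((∏ i, (if α i then (p i false - p i true) / 2 else (p i false + p i true) / 2)) * ∏ j, (if γ j then (q j false - q j true) / 2 else (q j false + q j true) / 2)) * (Z α γ : ℂ) := by
    rw [Finset.sum_eq_single (fun _ => false) (fun α _ hα => ?_) (fun h => (h (Finset.mem_univ _)).elim)]
    · rw [Finset.sum_eq_single (fun _ => false) (fun γ _ hγ => ?_) (fun h => (h (Finset.mem_univ _)).elim)]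
      · rw [prod_coef_false, prod_coef_false, hZdef]
        simp
      · rw [hZdef]
        simp [hγ]
    · refine Finset.sum_eq_zero fun γ _ => ?_
      rw [hZdef]
      simp [hα]
  rw [hexp, hzero, ← Finset.sum_sub_distrib]
  simp_rw [← Finset.sum_sub_distrib, ← mul_sub, ← Complex.ofReal_sub]
  -- bound term by term with `|W − Z| ≤ 2√2ⁿ`
  have hW : ∀ α γ, |W α γ - Z α γ| ≤ 2 * Real.sqrt 2 ^ n := fun α γ => abs_walsh_mask_sub_le hK e α γ
  calc ‖∑ α : Fin n → Bool, ∑ γ : Fin n → Bool,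
          ((∏ i, (if α i then (p i false - p i true) / 2 else (p i false + p i true) / 2)) * ∏ j, (if γ j then (q j false - q j true) / 2 else (q j false + q j true) / 2)) * ((W α γ - Z α γ : ℝ) : ℂ)‖
      ≤ ∑ α : Fin n → Bool, ∑ γ : Fin n → Bool,
          ‖∏ i, (if α i then (p i false - p i true) / 2 else (p i false + p i true) / 2)‖ * ‖∏ j, (if γ j then (q j false - q j true) / 2 else (q j false + q j true) / 2)‖ * (2 * Real.sqrt 2 ^ n) := by
        refine (norm_sum_le _ _).trans (Finset.sum_le_sum fun α _ => ?_)
        refine (norm_sum_le _ _).trans (Finset.sum_le_sum fun γ _ => ?_)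
        rw [norm_mul, norm_mul, Complex.norm_real, Real.norm_eq_abs]
        exact mul_le_mul_of_nonneg_left (hW α γ) (by positivity)
    _ = (∑ α : Fin n → Bool, ‖∏ i, (if α i then (p i false - p i true) / 2 else (p i false + p i true) / 2)‖) * (∑ γ : Fin n → Bool, ‖∏ j, (if γ j then (q j false - q j true) / 2 else (q j false + q j true) / 2)‖) *
          (2 * Real.sqrt 2 ^ n) := by
        rw [Finset.sum_mul_sum, Finset.sum_mul]
        refine Finset.sum_congr rfl fun α _ => ?_
        rw [Finset.sum_mul]
    _ = _ := by rw [sum_norm_prod_coef, sum_norm_prod_coef]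

end Inner

/-! ### One-site facts for `M = v σ_Q v†` -/

section Site

variable {v : Matrix Bool Bool ℂ}

/-- `v σ_Q v†` is Hermitian. -/
theorem conj_conjTranspose (Q : Pauli) : (v * Q.mat * star v)ᴴ = v * Q.mat * star v := by
  rw [Matrix.star_eq_conjTranspose, Matrix.conjTranspose_mul, Matrix.conjTranspose_mul,
    Matrix.conjTranspose_conjTranspose, Pauli.conjTranspose_mat, Matrix.mul_assoc]

/-- Hermitian symmetry of the off-diagonal entries of `v σ_Q v†`. -/
theorem conj_apply_true_false (Q : Pauli) :
    (v * Q.mat * star v) true false = star ((v * Q.mat * star v) false true) := by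
  conv_lhs => rw [← conj_conjTranspose Q]
  rw [Matrix.conjTranspose_apply]

/-- The diagonal entries of `v σ_Q v†` are real. -/
theorem star_conj_apply_false_false (Q : Pauli) :
    star ((v * Q.mat * star v) false false) = (v * Q.mat * star v) false false := by
  conv_rhs => rw [← conj_conjTranspose Q]
  rw [Matrix.conjTranspose_apply]

/-- Both rows of `M = v σ_Q v†` have the same coefficient mass
`½(‖M(b,0) + M(b,1)‖ + ‖M(b,0) − M(b,1)‖)`. -/
theorem rowMass_true_eq (hv : v ∈ Matrix.unitaryGroup Bool ℂ) (Q : Pauli) :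
    (‖(v * Q.mat * star v) true false + (v * Q.mat * star v) true true‖ +
        ‖(v * Q.mat * star v) true false - (v * Q.mat * star v) true true‖) / 2 =
      (‖(v * Q.mat * star v) false false + (v * Q.mat * star v) false true‖ +
        ‖(v * Q.mat * star v) false false - (v * Q.mat * star v) false true‖) / 2 := by
  by_cases hQ : Q = Pauli.I
  · subst hQ
    rw [OneSided.conj_I_eq_one hv]
    simp
  · rw [OneSided.conj_apply_true_true hv hQ, conj_apply_true_false Q]
    set m00 := (v * Q.mat * star v) false false
    set m01 := (v * Q.mat * star v) false true
    have h00 : star m00 = m00 := star_conj_apply_false_false Q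
    have e1 : star m01 + -m00 = star (m01 - m00) := by rw [star_sub, h00, sub_eq_add_neg]
    have e2 : star m01 - -m00 = star (m01 + m00) := by rw [star_add, h00, sub_neg_eq_add]
    rw [e1, e2, norm_star, norm_star, add_comm ‖m01 - m00‖, add_comm m01 m00, ← norm_neg (m01 - m00),
      neg_sub]

/-- Half row sums `r b = ½(M(b,0) + M(b,1))`: their coefficient mass is at most `2^{-1/2}`. -/
theorem halfRow_mass_le (hv : v ∈ Matrix.unitaryGroup Bool ℂ) (Q : Pauli) :
    (‖((v * Q.mat * star v) false false + (v * Q.mat * star v) false true) / 2 +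
          ((v * Q.mat * star v) true false + (v * Q.mat * star v) true true) / 2‖ +
        ‖((v * Q.mat * star v) false false + (v * Q.mat * star v) false true) / 2 -
          ((v * Q.mat * star v) true false + (v * Q.mat * star v) true true) / 2‖) / 2 ≤
      Real.sqrt 2 / 2 := by
  have hs2 : (1 : ℝ) < Real.sqrt 2 := Real.one_lt_sqrt_two
  by_cases hQ : Q = Pauli.I
  · subst hQ
    rw [OneSided.conj_I_eq_one hv]
    norm_num
    linarith
  · rw [OneSided.conj_apply_true_true hv hQ, conj_apply_true_false Q]
    set m00 := (v * Q.mat * star v) false false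
    set m01 := (v * Q.mat * star v) false true
    have h00 : star m00 = m00 := star_conj_apply_false_false Q
    have hrow : ‖m01‖ ^ 2 + ‖m00‖ ^ 2 = 1 :=
      OneSided.norm_sq_row_of_unitary (OneSided.conj_mem_unitaryGroup hv Q) false
    have eA : (m00 + m01) / 2 + (star m01 + -m00) / 2 = (m01 + star m01) / 2 := by ring
    have eB : (m00 + m01) / 2 - (star m01 + -m00) / 2 = m00 + (m01 - star m01) / 2 := by ring
    rw [eA, eB]
    -- the two pieces are `Re m01` and `m00 + i Im m01` (m00 is real): their squared norms add up to 1
    have h00im : m00.im = 0 := by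
      have := congrArg Complex.im h00
      simp only [Complex.star_def, Complex.conj_im] at this
      linarith
    have hre : (m01 + star m01) / 2 = ((m01.re : ℝ) : ℂ) := by
      apply Complex.ext <;> simp
    have hB : m00 + (m01 - star m01) / 2 = (⟨m00.re, m01.im⟩ : ℂ) := by
      apply Complex.ext <;> simp [h00im]
    have key : ‖(m01 + star m01) / 2‖ ^ 2 + ‖m00 + (m01 - star m01) / 2‖ ^ 2 = 1 := by
      rw [hre, hB, Complex.norm_real, Real.norm_eq_abs, sq_abs, Complex.sq_norm, Complex.normSq_mk, ← hrow,
        Complex.sq_norm, Complex.sq_norm, Complex.normSq_apply, Complex.normSq_apply, h00im]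
      ring
    set a := ‖(m01 + star m01) / 2‖
    set b := ‖m00 + (m01 - star m01) / 2‖
    have ha : 0 ≤ a := norm_nonneg _
    have hb : 0 ≤ b := norm_nonneg _
    have hab : (a + b) ^ 2 ≤ Real.sqrt 2 ^ 2 := by
      rw [Real.sq_sqrt (by norm_num : (0 : ℝ) ≤ 2)]
      nlinarith [sq_nonneg (a - b)]
    have hs : a + b ≤ Real.sqrt 2 := by
      nlinarith [Real.sqrt_nonneg 2]
    linarith

/-- The doubly-zero coefficient of a site: `‖Σ_{a,b} M(a,b)‖ / 4 ≤ 1/2`. -/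
theorem quarterSum_norm_le (hv : v ∈ Matrix.unitaryGroup Bool ℂ) (Q : Pauli) :
    ‖(((v * Q.mat * star v) false false + (v * Q.mat * star v) false true) / 2 +
        ((v * Q.mat * star v) true false + (v * Q.mat * star v) true true) / 2) / 2‖ ≤ 1 / 2 := by
  by_cases hQ : Q = Pauli.I
  · subst hQ
    rw [OneSided.conj_I_eq_one hv]
    norm_num
  · rw [OneSided.conj_apply_true_true hv hQ, conj_apply_true_false Q]
    set m01 := (v * Q.mat * star v) false true
    have h1 : ‖m01‖ ≤ 1 := entry_norm_bound_of_unitary (OneSided.conj_mem_unitaryGroup hv Q) _ _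
    have e : (((v * Q.mat * star v) false false + m01) / 2 +
        (star m01 + -(v * Q.mat * star v) false false) / 2) / 2 = (m01 + star m01) / 4 := by ring
    rw [e, norm_div, RCLike.norm_ofNat]
    have : ‖m01 + star m01‖ ≤ 2 := (norm_add_le _ _).trans (by rw [norm_star]; linarith)
    linarith

end Site

end HLike

/-- Registered alias (`stub_hlikeInner`, sub-goal of `stub_hlikeFlat` on stmt-QuantumAdvantage-0242): the
inner (column) sum of the row-Fourier method with its doubly-zero frequency removed is bounded by the
product of the two coefficient masses times the cube Walsh bound `2√2ⁿ`. -/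
theorem stub_hlikeInner : ∀ {n : ℕ} {K : Type} [Field K] [Fintype K], Fintype.card K = 2 ^ n →
    ∀ (e : K ≃+ (Fin n → ZMod 2)) (F : QReg n → QReg n),
    (∀ x j, F x j = decide (e ((e.symm fun i : Fin n => if x i then 1 else 0) ^ 3) j = 1)) →
    ∀ (p q : Fin n → Bool → ℂ),
    ‖(∑ x' : QReg n, (∏ i, p i (x' i)) * ∏ j, q j (F x' j)) -
        ((∏ i, (p i false + p i true) / 2) * ∏ j, (q j false + q j true) / 2) * (2 : ℂ) ^ n‖ ≤
      (∏ i, ((‖p i false + p i true‖ + ‖p i false - p i true‖) / 2)) *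
          (∏ j, ((‖q j false + q j true‖ + ‖q j false - q j true‖) / 2)) * (2 * Real.sqrt 2 ^ n) :=
  fun hK e F hF p q => HLike.norm_inner_sub_le hK e F hF p q

end Summit.QuantumAdvantage.QuantumAdvantage.Theorems.SymplecticPurity

end
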